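import Literature.Barriers.QuantumAdvantage.AaronsonChenOracleProofs
import Literature.Computability.QuantumComplexity.CoinFamilyKernel
import Literature.Computability.Cryptography.OracleAdversaryFPRel
import Literature.Computability.Complexity.OracleClosure
import Literature.Computability.Complexity.BranchingFn
import Literature.Computability.Complexity.BrickAlgebra
import HarnessLib

/-!
# `SampBPP^A ⊆ SampBQP^A` from the relativized reversible simulation; Aaronson–Chen Thm. 5.1 (first half) from its two leaves

Sibling proof file (theorems only) of `AaronsonChenOracle.lean`, for the named fact

* `SampPRel_subset_SampBQPRel` — "`SampBPP^A ⊆ SampBQP^A` for every oracle language `A`": the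
  trivial inclusion used tacitly in S. Aaronson, L. Chen, *Complexity-theoretic foundations of
  quantum supremacy experiments*, CCC 2017 (arXiv:1612.05903) [AaronsonChen2017], Thm. 5.1 /
  Cor. 5.2 (p. 21) and Thm. 8.1 (p. 32) (`PPolyOraclesProofs.lean`), i.e. the sampling form of
  Bernstein–Vazirani's `BPP ⊆ BQP` (SIAM J. Comput. 26 (1997), Thm. 8.3, relativized as in their
  §8.3 [BernsteinVazirani1997SICOMP]).

**Main result.** `SampPRel_subset_SampBQPRel_of_sim : uniformOracleCoinSimulation → SampPRel_subset_SampBQPRel`: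
the fact is reduced, by a proof, to the tree's named fact
`Literature.Computability.QuantumComplexity.uniformOracleCoinSimulation`
(`QuantumComplexity/CoinFamilyKernel.lean`: the polynomial-time uniform reversible simulation,
with oracle gates, of an `FP^A` function of `⟨x, coins⟩`, its output a prefix of the read-out —
whose coin-free one-bit case `uniformReversibleSimulation` is PROVED in the tree,
`QuantumComplexity/SimUniformity.lean`, giving `BPP_subset_BQP_holds`). Proof: a `SampBPP^A`
sampler is a PPT oracle adversary `𝒜` (C4a); the string function
`G ⟨w, r⟩ = ⟨out_𝒜(w; r), ε⟩` — the output of `𝒜` on `w` with coins `r` within its round budget,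
self-delimited by `boolPair · []` — is in `FP^A` (`OracleAdversary.clockedRun_mem_FPRel`,
`Cryptography/OracleAdversaryFPRel.lean`, with `FP_comp_mem_FPRel` of
`Complexity/OracleClosure.lean`); by `exists_uniform_kernelProb_ge_uniformProb` the uniform coin
family of the simulation fact, run on `|w⟩|0…0⟩` and measured on all wires, outputs with
probability at least `Pr_r[G ⟨w, r⟩ ∈ T]` a string with a prefix in `T`, for every `T`; the
polynomial-time post-processing `post = fstF` (first pairing projection, `BrickAlgebra.lean`)
reads the self-delimited output back (`fstF_eq_of_boolPair_nil_prefix`), so the law of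
`post ∘ (measured output)` dominates the output law of `𝒜` on every event, hence equals it
(`pmf_eq_of_toOuterMeasure_le`: two probability mass functions comparable on all events
coincide) — the same sampler accuracy `1/k`.

**Assemblies.** With the tree's reduction of the first half of Thm. 5.1 to Lemma 5.3
(`aaronsonChen2017_thm51_samp_of_lem53`, `AaronsonChenOracleProofs.lean`):
`aaronsonChen2017_thm51_samp_of_leaves : aaronsonChen2017_lem53 → uniformOracleCoinSimulation → aaronsonChen2017_thm51_samp`
and `aaronsonChen2017_cor52_of_leaves` (adding the `PH` half `aaronsonChen2017_thm51_ph`). So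
`aaronsonChen2017_thm51_samp_holds` awaits exactly `aaronsonChen2017_lem53_holds` (decomposed in
`AaronsonChenSimulation.lean` into `aaronsonChen2017_lem53_machine` and
`aaronsonChen2017_lem53_losses`) and `uniformOracleCoinSimulation_holds`.

## Design notes

* No definition is introduced (kernel-checked proof file); the self-delimiting map is the tree
  brick `fanoutFn id (fun _ => [])` (`z ↦ ⟨z, ε⟩`, `StringEquality.lean`).
* `pmf_eq_of_toOuterMeasure_le` is stated for Mathlib's `PMF` in this file's namespace (not as a
  `PMF.` dot-extension), pending a librarian home next to `PMF.tvDist`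
  (`Cryptography/StatisticalDistance.lean`).

## Sources

* [AaronsonChen2017] arXiv:1612.05903, Def. 2.3 ("Oracle versions of these classes can also be
  defined in the natural way", p. 12), Thm. 5.1 and Cor. 5.2 (p. 21), read via
  `lit read arxiv:1612.05903 --pages 12,21`.
* [BernsteinVazirani1997SICOMP] Thm. 8.3 (proof) and §8.3, as cited by
  `QuantumComplexity/CoinFamilyKernel.lean`.
-/

noncomputable section

namespace Literature.Barriers.QuantumAdvantage

open _root_.MeasureTheory _root_.Computability
open Literature.Computability.Complexity Literature.Computability.Complexity.Brick
  Literature.Computability.Cryptography Literature.Computability.QuantumComplexity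

/-! ### Two distributions comparable on every event are equal -/

/-- Outer-measure values of a probability mass function are finite. [folklore] -/
theorem pmf_toOuterMeasure_ne_top {α : Type*} (p : PMF α) (s : Set α) : p.toOuterMeasure s ≠ ⊤ :=
  ne_top_of_le_ne_top ENNReal.one_ne_top ((p.toOuterMeasure.mono (Set.subset_univ s)).trans
    ((PMF.toOuterMeasure_apply_eq_one_iff p Set.univ).2 (Set.subset_univ _)).le)

/-- **Two probability mass functions `p, q` with `p(S) ≤ q(S)` for every event `S` coincide**
(compare singletons; a strict inequality somewhere would make the total masses differ). [folklore] -/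
theorem pmf_eq_of_toOuterMeasure_le {α : Type*} (p q : PMF α)
    (h : ∀ S : Set α, p.toOuterMeasure S ≤ q.toOuterMeasure S) : p = q := by
  classical
  have hle : ∀ a, p a ≤ q a := fun a => by
    simpa [PMF.toOuterMeasure_apply_singleton] using h {a}
  ext a
  by_contra hne
  have hlt : p a < q a := lt_of_le_of_ne (hle a) hne
  have hp := p.tsum_coe
  have hq := q.tsum_coe
  rw [ENNReal.tsum_eq_add_tsum_ite a] at hp hq
  have hrest : (∑' b, ite (b = a) 0 (p b)) ≤ ∑' b, ite (b = a) 0 (q b) :=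
    ENNReal.tsum_le_tsum fun b => by split_ifs <;> simp [hle]
  have hfin : (∑' b, ite (b = a) 0 (p b)) ≠ ⊤ :=
    ne_top_of_le_ne_top ENNReal.one_ne_top (hp ▸ le_add_self)
  have : p a + ∑' b, ite (b = a) 0 (p b) < q a + ∑' b, ite (b = a) 0 (q b) :=
    calc p a + ∑' b, ite (b = a) 0 (p b) < q a + ∑' b, ite (b = a) 0 (p b) :=
          (ENNReal.add_lt_add_iff_right hfin).2 hlt
      _ ≤ q a + ∑' b, ite (b = a) 0 (q b) := add_le_add le_rfl hrest
  rw [hp, hq] at this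
  exact lt_irrefl _ this

/-! ### `SampBPP^A ⊆ SampBQP^A` from the relativized reversible simulation -/

/-- A self-delimited prefix is read back by the first pairing projection:
`⟨s, ε⟩ <+: y → fstF y = s`. [folklore] -/
theorem fstF_eq_of_boolPair_nil_prefix {s y : List Bool} (h : boolPair s [] <+: y) : fstF y = s := by
  obtain ⟨t, rfl⟩ := h
  have : boolPair s [] ++ t = boolPair s t := by simp [boolPair]
  rw [this, fstF_boolPair]

/-- **`SampBPP^A ⊆ SampBQP^A` for every oracle language `A`, from the relativized uniform
reversible simulation** `uniformOracleCoinSimulation` (Bernstein–Vazirani 1997, Thm. 8.3,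
relativized as in their §8.3). Given a `SampBPP^A` sampler `𝒜` for `S`: the self-delimited
output function `G ⟨w, r⟩ = ⟨out_𝒜(w; r), ε⟩` is in `FP^A`
(`OracleAdversary.clockedRun_mem_FPRel`, `FP_comp_mem_FPRel`); the coin family of
`exists_uniform_kernelProb_ge_uniformProb` outputs, with probability at least
`Pr_r[G ⟨w, r⟩ ∈ T]`, a string with a prefix in `T`; reading the prefix back (`post = fstF ∈ FP`)
gives an output law dominating, hence equal to (`pmf_eq_of_toOuterMeasure_le`), the output law
of `𝒜` on `w` — so the same accuracy `1/k`.
[cite: BernsteinVazirani1997SICOMP, Thm. 8.3 (proof) and §8.3] [cite: AaronsonChen2017, Def. 2.3 (oracle versions of SampBPP, SampBQP)] -/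
theorem SampPRel_subset_SampBQPRel_of_sim (hsim : uniformOracleCoinSimulation) :
    SampPRel_subset_SampBQPRel := by
  classical
  rintro A D ⟨𝒜, h𝒜, hacc⟩
  set G₀ : List Bool → List Bool := fun w =>
    (𝒜.alg.run (Oracle.ofLanguage A) (𝒜.fuel.eval (boolUnpair w).1.length) w).getD [] with hG₀
  have hG₀mem : G₀ ∈ FPRel (Oracle.ofLanguage A) := 𝒜.clockedRun_mem_FPRel h𝒜 A
  have hG'mem : fanoutFn id (fun _ => []) ∘ G₀ ∈ FPRel (Oracle.ofLanguage A) :=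
    FP_comp_mem_FPRel hG₀mem (fanoutFn_mem_FP (PolyTimeComputable.id _) (const_mem_FP []))
  obtain ⟨F, hU, hF⟩ := exists_uniform_kernelProb_ge_uniformProb hsim A _ 𝒜.coins hG'mem
  refine ⟨F, fstF, hU, fstF_mem_FP, fun x k hk => ?_⟩
  set w := boolPair x (unaryEncodeNat k) with hw
  have hPQ : PMF.map (fun o => o.getD []) (𝒜.outputPMF (Oracle.ofLanguage A) w) =
      (F.kernel A w).map fstF := by
    refine pmf_eq_of_toOuterMeasure_le _ _ fun S => ?_
    -- the coin strings producing an output in `S`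
    have hset : (fun r : List.Vector Bool (𝒜.coins.eval w.length) =>
          𝒜.alg.run (Oracle.ofLanguage A) (𝒜.fuel.eval w.length) (boolPair w r.toList)) ⁻¹'
            ((fun o : Option (List Bool) => o.getD []) ⁻¹' S) =
        {r | r.toList ∈ {c | (fanoutFn id (fun _ => []) ∘ G₀) (boolPair w c) ∈
          (fun s => boolPair s []) '' S}} := by
      ext r
      simp only [Set.mem_preimage, Set.mem_setOf_eq, Function.comp_apply, fanoutFn_apply, id,
        hG₀, boolUnpair_boolPair]
      constructor
      · intro h
        exact ⟨_, h, rfl⟩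
      · rintro ⟨s, hs, heq⟩
        exact (QCircuit.boolPair_inj heq).1 ▸ hs
    calc (PMF.map (fun o => o.getD []) (𝒜.outputPMF (Oracle.ofLanguage A) w)).toOuterMeasure S
        = (PMF.uniformOfFintype (List.Vector Bool (𝒜.coins.eval w.length))).toOuterMeasure
            {r | r.toList ∈ {c | (fanoutFn id (fun _ => []) ∘ G₀) (boolPair w c) ∈
              (fun s => boolPair s []) '' S}} := by
          rw [PMF.toOuterMeasure_map_apply, OracleAdversary.outputPMF_eq_map,
            PMF.toOuterMeasure_map_apply, hset]
      _ = ENNReal.ofReal (uniformProb (𝒜.coins.eval w.length)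
            {c | (fanoutFn id (fun _ => []) ∘ G₀) (boolPair w c) ∈ (fun s => boolPair s []) '' S}) := by
          rw [uniformProb_eq_toOuterMeasure, ENNReal.ofReal_toReal (pmf_toOuterMeasure_ne_top _ _)]
      _ ≤ ENNReal.ofReal (F.kernelProb A w
            {y | ∃ s ∈ (fun s => boolPair s []) '' S, s <+: y}) := ENNReal.ofReal_le_ofReal (hF w _)
      _ = (F.kernel A w).toOuterMeasure {y | ∃ s ∈ (fun s => boolPair s []) '' S, s <+: y} := by
          rw [QCircuitFamily.kernelProb, ENNReal.ofReal_toReal (pmf_toOuterMeasure_ne_top _ _)]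
      _ ≤ (F.kernel A w).toOuterMeasure (fstF ⁻¹' S) := by
          refine (F.kernel A w).toOuterMeasure.mono ?_
          rintro y ⟨s, ⟨s₀, hs₀, rfl⟩, hpre⟩
          show fstF y ∈ S
          rw [fstF_eq_of_boolPair_nil_prefix hpre]
          exact hs₀
      _ = ((F.kernel A w).map fstF).toOuterMeasure S := (PMF.toOuterMeasure_map_apply _ _ _).symm
  rw [← hPQ]
  exact hacc x k hk

/-! ### Theorem 5.1 (first half) and Cor. 5.2 from their leaves -/

/-- **Aaronson–Chen 2017, Thm. 5.1, first half, from its two leaves**: Lemma 5.3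
(`aaronsonChen2017_lem53`) and the relativized reversible simulation
(`uniformOracleCoinSimulation`, for the trivial inclusion).
[cite: AaronsonChen2017, Thm. 5.1 (p. 21)] -/
theorem aaronsonChen2017_thm51_samp_of_leaves (h53 : aaronsonChen2017_lem53)
    (hsim : uniformOracleCoinSimulation) : aaronsonChen2017_thm51_samp :=
  aaronsonChen2017_thm51_samp_of_lem53 h53 (SampPRel_subset_SampBQPRel_of_sim hsim)

/-- **Cor. 5.2 from its three leaves**: Lemma 5.3, the relativized reversible simulation and the
second half of Thm. 5.1 (`PH^{TQBF,O}` infinite almost surely).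
[cite: AaronsonChen2017, Cor. 5.2 (p. 21)] -/
theorem aaronsonChen2017_cor52_of_leaves (h53 : aaronsonChen2017_lem53)
    (hsim : uniformOracleCoinSimulation) (hph : aaronsonChen2017_thm51_ph) :
    aaronsonChen2017_cor52 :=
  aaronsonChen2017_cor52_of_lem53 h53 (SampPRel_subset_SampBQPRel_of_sim hsim) hph

end Literature.Barriers.QuantumAdvantage

end
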